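import Summits.AtomisticToContinuum.Crystallization.Theses.ChessboardParticlePlanes

/-!
# Crux `LjPlaneChessboard` (stmt-AtomisticToContinuum-6709), line `Sketch` — stub `stub_restack`

The period-2 restack of two occupied layers of a periodic configuration `Q` of `ℝ³` is the point
set of a periodic configuration.

Given two `ℝ`-independent horizontal periods `a, b ∈ G` (`a₂ = b₂ = 0`) of `Q` and two occupied
heights `t < t'`, put `c := 2(t' − t) > 0`, `e := e₃` and

  `R := {x + c k • e : x ∈ Q.points, x₂ ∈ {t, t'}, k ∈ ℤ}`.

* `a, b, c • e` are `ℝ`-linearly independent (coordinate `2` of a vanishing combination kills the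
  coefficient of `c • e`, then independence of `a, b`), hence form a basis `β` of `ℝ³`; the
  lattice of the restack is `L := span_ℤ {a, b, c • e}`, a `ZSpan` (Mathlib supplies
  discreteness and full rank).
* `R` is `L`-invariant: `x ↦ x + n₀ a + n₁ b` preserves `Q.points` and the height, and
  `n₂ (c • e)` shifts `k`.
* `R` has finitely many points in the (bounded) fundamental domain of `β`: the height of
  `x + c k • e` is `x₂ + c k` with `x₂ ∈ {t, t'}`, so only finitely many `k` occur, and for each
  `k` the points `x` lie in a fixed ball, where `Q` has finitely many points.
* A set invariant under the `ℤ`-span of a basis with finite trace `M` on the fundamental domain is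
  the point set `M + L` of the periodic configuration `(L, M)`: `ZSpan.fract` gives the
  representative in the fundamental domain, unique modulo `L`.

No definition is introduced; the configuration is built as an anonymous structure instance.
-/

noncomputable section

namespace Summit.AtomisticToContinuum.Crystallization.Theorems.ChessboardParticlePlanesLjPlaneChessboard

open Literature.MathematicalPhysics.StatisticalMechanics

/-- A subset `R` of `ℝ³` invariant under the `ℤ`-span `L` of a basis `β` and with finitely many
points in the fundamental domain of `β` is the point set of a periodic configuration, namely
`(L, R ∩ fundamentalDomain β)`: every point has a unique `L`-translate (`ZSpan.fract`) in the
fundamental domain. [folklore] -/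
theorem restack_exists_periodicConfiguration_of_invariant
    (β : Module.Basis (Fin 3) ℝ (EuclideanSpace ℝ (Fin 3))) {R : Set (EuclideanSpace ℝ (Fin 3))}
    (hne : R.Nonempty)
    (hinv : ∀ g ∈ Submodule.span ℤ (Set.range β), ∀ p ∈ R, p + g ∈ R)
    (hfin : (ZSpan.fundamentalDomain β ∩ R).Finite) :
    ∃ B : PeriodicConfiguration 3, B.points = R := by
  have hfract : ∀ p ∈ R, ZSpan.fract β p ∈ ZSpan.fundamentalDomain β ∩ R := fun p hp =>
    ⟨ZSpan.fract_mem_fundamentalDomain β p, by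
      rw [ZSpan.fract_apply, sub_eq_add_neg]
      exact hinv _ (Submodule.neg_mem _ (ZSpan.floor β p).2) p hp⟩
  obtain ⟨p₀, hp₀⟩ := hne
  refine ⟨{ lattice := Submodule.span ℤ (Set.range β)
            discrete := inferInstance
            isZLattice := inferInstance
            motif := hfin.toFinset
            motif_nonempty := ⟨ZSpan.fract β p₀, hfin.mem_toFinset.2 (hfract p₀ hp₀)⟩
            eq_of_sub_mem := ?_ }, ?_⟩
  · intro x hx y hy hxy
    rw [Set.Finite.mem_toFinset] at hx hy
    calc x = ZSpan.fract β x := (ZSpan.fract_eq_self.2 hx.1).symm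
      _ = ZSpan.fract β (x - y + y) := by rw [sub_add_cancel]
      _ = ZSpan.fract β y := ZSpan.fract_zSpan_add β y hxy
      _ = y := ZSpan.fract_eq_self.2 hy.1
  · ext p
    simp only [PeriodicConfiguration.points, Set.mem_setOf_eq, Set.Finite.mem_toFinset]
    constructor
    · rintro ⟨y, hy, g, hg, rfl⟩
      exact hinv g hg y hy.2
    · intro hp
      exact ⟨ZSpan.fract β p, hfract p hp, ZSpan.floor β p, (ZSpan.floor β p).2, by
        rw [ZSpan.fract_apply, sub_add_cancel]⟩

/-- Two `ℝ`-independent horizontal vectors `a, b` (`a₂ = b₂ = 0`) together with a non-zero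
vertical vector `c • e₃` are `ℝ`-linearly independent in `ℝ³`. [folklore] -/
theorem restack_linearIndependent {a b : EuclideanSpace ℝ (Fin 3)} (ha : a 2 = 0) (hb : b 2 = 0)
    (hab : LinearIndependent ℝ ![a, b]) {c : ℝ} (hc : c ≠ 0) :
    LinearIndependent ℝ ![a, b, c • EuclideanSpace.single (2 : Fin 3) (1 : ℝ)] := by
  rw [Fintype.linearIndependent_iff]
  intro g hg
  have h2 := congrArg (fun x : EuclideanSpace ℝ (Fin 3) => x 2) hg
  simp [Fin.sum_univ_three, ha, hb, hc] at h2
  rw [Fin.sum_univ_three, h2, zero_smul, add_zero] at hg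
  simp only [Matrix.cons_val_zero, Matrix.cons_val_one] at hg
  obtain ⟨h0, h1⟩ := LinearIndependent.pair_iff.1 hab _ _ hg
  intro i
  fin_cases i <;> assumption

/-- **Stub 3 — the restack is a periodic configuration.**  Given two horizontal `ℝ`-independent
periods of `Q` and two occupied heights `t < t'`, the period-2 restack
`{x + 2k(t'−t)e₃ : x ∈ Q.points, x₂ ∈ {t, t'}, k ∈ ℤ}` of the layers at `t` and `t'` is the
point set of a periodic configuration of `ℝ³`: lattice `span_ℤ {a, b, 2(t'−t)e₃}`, motif = the
(finite) trace of the restack on the fundamental domain of that basis. [folklore] -/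
theorem stub_restack :
    ∀ Q : PeriodicConfiguration 3,
      (∃ a ∈ Q.lattice, ∃ b ∈ Q.lattice, a 2 = 0 ∧ b 2 = 0 ∧ LinearIndependent ℝ ![a, b]) →
      ∀ t t' : ℝ, t < t' → (∃ x ∈ Q.points, x 2 = t) → (∃ x ∈ Q.points, x 2 = t') →
      ∃ B : PeriodicConfiguration 3,
        B.points = {p : EuclideanSpace ℝ (Fin 3) | ∃ k : ℤ, ∃ x ∈ Q.points, (x 2 = t ∨ x 2 = t') ∧
          p = x + ((2 * (t' - t)) * (k : ℝ)) • EuclideanSpace.single (2 : Fin 3) (1 : ℝ)} := by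
  intro Q ⟨a, ha, b, hb, ha2, hb2, hab⟩ t t' htt ⟨x₀, hx₀, hx₀t⟩ _
  -- the vertical period `c = 2 (t' - t) > 0`
  set c : ℝ := 2 * (t' - t) with hc
  have hc0 : 0 < c := by rw [hc]; linarith
  -- the basis `β = (a, b, c • e₃)` of `ℝ³`
  obtain ⟨β, hβ⟩ : ∃ β : Module.Basis (Fin 3) ℝ (EuclideanSpace ℝ (Fin 3)),
      ⇑β = ![a, b, c • EuclideanSpace.single (2 : Fin 3) (1 : ℝ)] :=
    ⟨basisOfLinearIndependentOfCardEqFinrank (restack_linearIndependent ha2 hb2 hab hc0.ne')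
      (by simp), coe_basisOfLinearIndependentOfCardEqFinrank _ _⟩
  refine restack_exists_periodicConfiguration_of_invariant β
    ⟨x₀, 0, x₀, hx₀, Or.inl hx₀t, by simp⟩ ?_ ?_
  · -- invariance of the restack under `span_ℤ {a, b, c • e₃}`
    intro g hg p hp
    rw [hβ, Submodule.mem_span_range_iff_exists_fun] at hg
    obtain ⟨n, rfl⟩ := hg
    obtain ⟨k, x, hx, hxt, rfl⟩ := hp
    refine ⟨k + n 2, x + ((n 0 : ℝ) • a + (n 1 : ℝ) • b), ?_, ?_, ?_⟩
    · refine Q.add_mem_points hx (Q.lattice.add_mem ?_ ?_)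
      · rw [Int.cast_smul_eq_zsmul]; exact Q.lattice.smul_mem _ ha
      · rw [Int.cast_smul_eq_zsmul]; exact Q.lattice.smul_mem _ hb
    · simpa [ha2, hb2] using hxt
    · rw [Fin.sum_univ_three]
      simp only [Matrix.cons_val_zero, Matrix.cons_val_one, Matrix.cons_val_two, Matrix.tail_cons,
        Matrix.head_cons, ← Int.cast_smul_eq_zsmul ℝ]
      push_cast
      module
  · -- finitely many restack points in the (bounded) fundamental domain
    obtain ⟨r, hr⟩ := isBounded_iff_forall_norm_le.1 (ZSpan.fundamentalDomain_isBounded β)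
    refine ((Set.finite_Icc (-⌈(r + |t| + |t'|) / c⌉) ⌈(r + |t| + |t'|) / c⌉).biUnion
      fun k _ => ((Q.finite_inter_points (Metric.isBounded_closedBall (x := 0)
        (r := 2 * r + |t| + |t'|))).image fun x : EuclideanSpace ℝ (Fin 3) =>
          x + (c * (k : ℝ)) • EuclideanSpace.single (2 : Fin 3) (1 : ℝ))).subset ?_
    rintro p ⟨hpK, k, x, hx, hxt, rfl⟩
    have hnorm := hr _ hpK
    have happ :
        (x + (c * (k : ℝ)) • EuclideanSpace.single (2 : Fin 3) (1 : ℝ)) 2 = x 2 + c * k := by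
      simp
    have h2 : |x 2 + c * k| ≤ r := by
      have h := PiLp.norm_apply_le (x + (c * (k : ℝ)) • EuclideanSpace.single (2 : Fin 3) (1 : ℝ)) 2
      rw [happ, Real.norm_eq_abs] at h
      exact h.trans hnorm
    have hx2 : |x 2| ≤ |t| + |t'| := by
      rcases hxt with h | h
      · rw [h]; linarith [abs_nonneg t']
      · rw [h]; linarith [abs_nonneg t]
    have hck : |c * k| ≤ r + |t| + |t'| := by
      calc |c * k| = |(x 2 + c * k) - x 2| := by rw [add_sub_cancel_left]
        _ ≤ |x 2 + c * k| + |x 2| := abs_sub _ _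
        _ ≤ r + (|t| + |t'|) := add_le_add h2 hx2
        _ = r + |t| + |t'| := (add_assoc _ _ _).symm
    have hk : |(k : ℝ)| ≤ (r + |t| + |t'|) / c := by
      rw [le_div_iff₀ hc0, mul_comm, ← abs_of_pos hc0, ← abs_mul]
      exact hck
    have hceil := Int.le_ceil ((r + |t| + |t'|) / c)
    refine Set.mem_biUnion (x := k) ⟨?_, ?_⟩ ⟨x, ⟨?_, hx⟩, rfl⟩
    · have h : ((-⌈(r + |t| + |t'|) / c⌉ : ℤ) : ℝ) ≤ k := by
        push_cast; linarith [(abs_le.1 hk).1]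
      exact_mod_cast h
    · have h : ((k : ℤ) : ℝ) ≤ (⌈(r + |t| + |t'|) / c⌉ : ℤ) := (abs_le.1 hk).2.trans hceil
      exact_mod_cast h
    · rw [Metric.mem_closedBall, dist_zero_right]
      calc ‖x‖ = ‖x + (c * (k : ℝ)) • EuclideanSpace.single (2 : Fin 3) (1 : ℝ) -
            (c * (k : ℝ)) • EuclideanSpace.single (2 : Fin 3) (1 : ℝ)‖ := by
            rw [add_sub_cancel_right]
        _ ≤ ‖x + (c * (k : ℝ)) • EuclideanSpace.single (2 : Fin 3) (1 : ℝ)‖ +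
            ‖(c * (k : ℝ)) • EuclideanSpace.single (2 : Fin 3) (1 : ℝ)‖ := norm_sub_le _ _
        _ ≤ r + (r + |t| + |t'|) := by
            refine add_le_add hnorm ?_
            rw [norm_smul, PiLp.norm_single, norm_one, mul_one, Real.norm_eq_abs]
            exact hck
        _ = 2 * r + |t| + |t'| := by ring

end Summit.AtomisticToContinuum.Crystallization.Theorems.ChessboardParticlePlanesLjPlaneChessboard

end
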